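import Summits.QuantumAdvantage.QuantumAdvantage.Theses.SosSandwich
import Summits.QuantumAdvantage.QuantumAdvantage.Theorems.SosSandwichPseudoBoundedAACompletelyBoundedCorner
import HarnessLib

/-!
# Crux `PseudoBoundedAA` (stmt-QuantumAdvantage-15237) — the COMPLETELY-BOUNDED CORNER, part 4: a kernel ONE-STUB
# LINE «CB»: polynomial growth of the ordered completely bounded norm on `K_T` implies the crux BY NAME

Parts 1–3 proved PB-AA on the corner `{ordered cb-norm ≤ K}` with `∃ i, (ε/(T K))² ≤ Infᵢ[p]`.  Consequently the crux follows
from ONE structural statement about the SOS-sandwich class, with no influence, junta or hypercontractivity content left: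

  «CB-growth»  `∃ κ C, 0 < C ∧ ∀ N T p, 1 ≤ T → p ∈ K_T → ordered-cb(p) ≤ C · T^κ`,

where `ordered-cb(p) ≤ K` is the def-free hypothesis of parts 2–3 (`⟨f, p(A) v⟩ ≤ K` for all contractions
`A_j ∈ M_m(ℝ)` and unit `v, f`, `p(A) = Σ_S p̂(S) A_{s₁}⋯A_{s_k}` in increasing order of the variables).  Then
`pseudoBoundedAA_of_cbGrowth : CB-growth → PseudoBoundedAA` with `(c, C') = (2κ + 2, 1/C²)` (using `ε ≤ Var ≤ 1`).

Honest flags.  (i) CB-growth is of UNKNOWN truth value; it is NOT refuted by the tree's refuting families: the self-composed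
address family of `not_HomogeneousPBAA` forces only `ordered-cb ≥ √T/2` (part 3, `cbNorm_ge_of_flat_influences`), i.e. it is
consistent with `κ = 1/2`; for general BOUNDED degree-3 polynomials the (Fourier) cb-norms are unbounded relative to the sup norm
(Briët–Palazuelos, quoted in Escudero Gutiérrez footnote 3), but those examples are not known to lie in `K_T` for bounded `T`.
(ii) The variable ORDER is free: any fixed numbering of the variables may be used before applying the line (the hypothesis here is
for the given numbering; a refinement «for some order» would need the obvious relabelling lemma).  (iii) This is a reduction
(kernel one-stub line in the sense of evidence #54's menu RS/RA/DecoupledCoreAA), not progress on the truth of the crux; no stub,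
crux or summit is closed.
Sources: EscuderoGutierrez2023 (arXiv:2304.06713) Thm. 1.8, footnote 3; BansalSinhaDeWolf2022 (arXiv:2203.00212) Thm. 1.3;
KaniewskiLeeDewolf2015 Def. 7; AaronsonAmbainis2014 Conj. 6.
-/

-- D-0017: single-conjunct summit ⇒ the duplicate `QuantumAdvantage.QuantumAdvantage` is mandated.
set_option linter.dupNamespace false

noncomputable section

open Finset Matrix
open Literature.Computability.QuantumComplexity
open Literature.Computability.Complexity.LowDegree (cubeFourierCoeff sum_cubeFourierCoeff_sq)

namespace Summit.QuantumAdvantage.QuantumAdvantage.Theorems.SosSandwich.CompletelyBoundedCorner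

variable {N : ℕ}

/-- `Var[p] ≤ 1` for `p ∈ K_T` (`0 ≤ p ≤ 1` on the cube, so `E[(p − E p)²] ≤ E[p²] ≤ 1`).
[cite: KaniewskiLeeDewolf2015, Def. 7] -/
theorem boolVariance_le_one_of_pseudoBounded {T : ℕ} {p : MvPolynomial (Fin N) ℝ} (hp : PseudoBounded T p) :
    boolVariance p ≤ 1 := by
  rw [SpectralCorner.boolVariance_eq_sum_sq_sub_empty]
  have h1 : ∑ S, cubeFourierCoeff (evalBool p) S ^ 2 ≤ 1 := sum_sq_fourier_le_one hp.bounded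
  nlinarith [sq_nonneg (cubeFourierCoeff (evalBool p) ∅)]

/-- **Kernel one-stub line «CB» for the crux.**  If the ordered completely bounded norm grows at most polynomially
on the SOS-sandwich classes — `∃ κ C > 0, ∀ N T p, T ≥ 1 → p ∈ K_T → ⟨f, p(A) v⟩ ≤ C·T^κ` for all contractions `A_j`
and unit `v, f` — then the route decl `PseudoBoundedAA` holds, with `(c, C') = (2κ + 2, 1/C²)`:
`Infᵢ ≥ (ε/(T·C T^κ))² = ε²/(C² T^{2κ+2}) ≥ (1/C²)(ε/T)^{2κ+2}` as `ε ≤ Var ≤ 1`.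
[cite: EscuderoGutierrez2023, Thm. 1.8] [cite: BansalSinhaDeWolf2022, Thm. 1.3] [cite: AaronsonAmbainis2014, Conj. 6] -/
theorem pseudoBoundedAA_of_cbGrowth
    (hCB : ∃ (κ : ℕ) (C : ℝ), 0 < C ∧ ∀ (N T : ℕ) (p : MvPolynomial (Fin N) ℝ), 1 ≤ T → PseudoBounded T p →
      ∀ (m : ℕ) (A : Fin N → Matrix (Fin m) (Fin m) ℝ) (v f : Fin m → ℝ),
        (∀ j w, ∑ a, (A j *ᵥ w) a ^ 2 ≤ ∑ a, w a ^ 2) → ∑ a, v a ^ 2 = 1 → ∑ a, f a ^ 2 = 1 →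
        f ⬝ᵥ ((∑ S : Finset (Fin N), cubeFourierCoeff (evalBool p) S • ((S.sort).map A).prod) *ᵥ v) ≤
          C * (T : ℝ) ^ κ) :
    Summit.QuantumAdvantage.QuantumAdvantage.Theses.SosSandwich.PseudoBoundedAA := by
  obtain ⟨κ, C, hC, hCB⟩ := hCB
  unfold Summit.QuantumAdvantage.QuantumAdvantage.Theses.SosSandwich.PseudoBoundedAA
  refine ⟨2 * κ + 2, 1 / C ^ 2, by positivity, ?_⟩
  intro N T p ε ev avg hT hPB hε hv
  change PseudoBounded T p at hPB
  change ε ≤ boolVariance p at hv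
  change ∃ i : Fin N, 1 / C ^ 2 * (ε / T) ^ (2 * κ + 2) ≤ influence i p
  have hT0 : (0 : ℝ) < T := by exact_mod_cast (show 0 < T by omega)
  have hK : 0 < C * (T : ℝ) ^ κ := mul_pos hC (pow_pos hT0 κ)
  obtain ⟨i, hi⟩ := pseudoBoundedAA_cbCorner hT p hPB hK (hCB N T p hT hPB) hε hv
  refine ⟨i, le_trans ?_ hi⟩
  -- `(1/C²)(ε/T)^{2κ+2} ≤ (ε/(T · C T^κ))²` since `ε ≤ 1`
  have hε1 : ε ≤ 1 := hv.trans (boolVariance_le_one_of_pseudoBounded hPB)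
  have hεT : ε / T ≤ 1 := by
    rw [div_le_one hT0]
    exact hε1.trans (by exact_mod_cast hT)
  have hεT0 : 0 ≤ ε / T := div_nonneg hε.le hT0.le
  have hpow : (ε / T) ^ (2 * κ + 2) ≤ (ε / T) ^ 2 * ((1 / (T : ℝ)) ^ κ) ^ 2 := by
    -- `(ε/T)^{2κ} ≤ (1/T)^{2κ}` is too weak in general; use `(ε/T)^{2κ+2} = (ε/T)² ((ε/T)^κ)²` and `(ε/T)^κ ≤ (1/T)^κ`
    have h1 : (ε / T) ^ κ ≤ (1 / (T : ℝ)) ^ κ :=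
      pow_le_pow_left₀ hεT0 (by rw [div_le_div_iff_of_pos_right hT0]; exact hε1) κ
    have h2 : 0 ≤ (ε / T) ^ κ := pow_nonneg hεT0 κ
    calc (ε / T) ^ (2 * κ + 2) = (ε / T) ^ 2 * ((ε / T) ^ κ) ^ 2 := by ring
      _ ≤ (ε / T) ^ 2 * ((1 / (T : ℝ)) ^ κ) ^ 2 := by
          apply mul_le_mul_of_nonneg_left _ (sq_nonneg _)
          exact pow_le_pow_left₀ h2 h1 2
  have hC2 : 0 < C ^ 2 := pow_pos hC 2
  calc 1 / C ^ 2 * (ε / T) ^ (2 * κ + 2) ≤ 1 / C ^ 2 * ((ε / T) ^ 2 * ((1 / (T : ℝ)) ^ κ) ^ 2) :=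
        mul_le_mul_of_nonneg_left hpow (by positivity)
    _ = (ε / (T * (C * (T : ℝ) ^ κ))) ^ 2 := by
        have hTk : (T : ℝ) ^ κ ≠ 0 := pow_ne_zero κ hT0.ne'
        rw [_root_.one_div_pow]
        field_simp

end Summit.QuantumAdvantage.QuantumAdvantage.Theorems.SosSandwich.CompletelyBoundedCorner

end
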